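import Literature.ModelTheory.ExponentialFields.OMinimalDefinability
import Mathlib.Data.Fin.Tuple.Basic
import HarnessLib

/-!
# Definability kit, III: blocks of variables and tuples read through `Fin.snoc`

Topic `Literature/ModelTheory/ExponentialFields`.  Bookkeeping complements to the kit of
`OMinimalDefinability.lean`, for first-order conditions on tuples `v ∈ M^γ` that quantify
over *blocks* of variables (points of `M^n`) and speak about membership of re-indexed
sub-tuples in a given definable set — the shape of the conditions "`x` lies in a box",
"`B` is a `Y`-good box", "`x` is a `Y`-good point" of the proof of the cell decomposition
theorem (L. van den Dries, *Tame topology and o-minimal structures* (1998), Ch. 3, (2.13)):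

* `definable_setOf_exists_fin`, `definable_setOf_forall_fin` — quantification over a block
  `u ∈ M^{Fin n}` (Mathlib's `Set.Definable.image_comp_sumInl_fin`, reshaped);
* `definable_setOf_comp_mem` — `{v | v ∘ τ ∈ S}` for a definable `S ⊆ M^β` and a re-indexing
  `τ : β → γ`; `definable_setOf_snoc_snoc_mem` — the instance
  `{v | ((v ∘ σ), v i, v j) ∈ S}` for `S ⊆ M^{k+2}` written with `Fin.snoc`;
* `definable_setOf_forall_index` — finite conjunctions indexed by a finite type (boxes:
  `∀ l, v (a l) < v (x l) ∧ v (x l) < v (b l)`).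

Nothing here is a named fact; everything is folklore bookkeeping (van den Dries 1998, Ch. 1,
(2.3): definable sets are closed under boolean operations, products and projections).

## References

* [Dries1998] L. van den Dries, *Tame topology and o-minimal structures*, London Math. Soc.
  Lecture Note Series 248, CUP 1998, Ch. 1, (2.3).
-/

open Set FirstOrder FirstOrder.Language

namespace Literature.ModelTheory.ExponentialFields

universe u v

variable {L : Language.{u, v}} {M : Type*} [L.Structure M] {γ : Type*}

/-! ### Blocks of variables -/

/-- **Existential quantification over a block of `n` variables** preserves definability
(van den Dries 1998, Ch. 1, (2.3)(iv): projections of definable sets are definable; Mathlib's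
`Set.Definable.image_comp_sumInl_fin`). The block is the `Fin n` summand of `γ ⊕ Fin n`. [cite: Dries1998, Ch. 1 (2.3)] -/
theorem definable_setOf_exists_fin {n : ℕ} {P : (γ → M) → (Fin n → M) → Prop}
    (h : (univ : Set M).Definable L
      {w : γ ⊕ Fin n → M | P (fun i => w (Sum.inl i)) (fun j => w (Sum.inr j))}) :
    (univ : Set M).Definable L {v : γ → M | ∃ u : Fin n → M, P v u} := by
  have h' := h.image_comp_sumInl_fin n
  convert h' using 1
  ext v
  simp only [mem_setOf_eq, mem_image]
  constructor
  · rintro ⟨u, hu⟩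
    refine ⟨Sum.elim v u, by simpa using hu, ?_⟩
    funext i
    simp
  · rintro ⟨w, hw, rfl⟩
    exact ⟨fun j => w (Sum.inr j), hw⟩

/-- **Universal quantification over a block of `n` variables** preserves definability
(complement of an existential). [cite: Dries1998, Ch. 1 (2.3)] -/
theorem definable_setOf_forall_fin {n : ℕ} {P : (γ → M) → (Fin n → M) → Prop}
    (h : (univ : Set M).Definable L
      {w : γ ⊕ Fin n → M | P (fun i => w (Sum.inl i)) (fun j => w (Sum.inr j))}) :
    (univ : Set M).Definable L {v : γ → M | ∀ u : Fin n → M, P v u} := by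
  have h' := (definable_setOf_exists_fin (P := fun v u => ¬ P v u) h.compl).compl
  convert h' using 1
  ext v
  simp

/-! ### Re-indexed sub-tuples in a definable set -/

/-- For a definable `S ⊆ M^β` and a re-indexing `τ : β → γ`, the set of `v ∈ M^γ` with
`v ∘ τ ∈ S` is definable (Mathlib's `Set.Definable.preimage_comp`, restated). [cite: Dries1998, Ch. 1 (2.3)] -/
theorem definable_setOf_comp_mem {β : Type*} {S : Set (β → M)}
    (hS : (univ : Set M).Definable L S) (τ : β → γ) :
    (univ : Set M).Definable L {v : γ → M | v ∘ τ ∈ S} :=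
  hS.preimage_comp τ

/-- The tuple `((v ∘ σ), v i, v j) ∈ M^{k+2}` built with `Fin.snoc` is the re-indexing of `v`
along `Fin.snoc (Fin.snoc σ i) j`. [folklore] -/
theorem snoc_snoc_comp_eq {k : ℕ} (v : γ → M) (σ : Fin k → γ) (i j : γ) :
    (Fin.snoc (Fin.snoc (fun l => v (σ l)) (v i) : Fin (k + 1) → M) (v j) : Fin (k + 2) → M) =
      v ∘ (Fin.snoc (Fin.snoc σ i : Fin (k + 1) → γ) j : Fin (k + 2) → γ) := by
  funext l
  refine Fin.lastCases ?_ (fun l' => ?_) l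
  · simp
  · refine Fin.lastCases ?_ (fun l'' => ?_) l'
    · simp
    · simp

/-- The tuple `((v ∘ σ), v i) ∈ M^{k+1}` built with `Fin.snoc` is the re-indexing of `v` along
`Fin.snoc σ i`. [folklore] -/
theorem snoc_comp_eq {k : ℕ} (v : γ → M) (σ : Fin k → γ) (i : γ) :
    (Fin.snoc (fun l => v (σ l)) (v i) : Fin (k + 1) → M) = v ∘ (Fin.snoc σ i : Fin (k + 1) → γ) := by
  funext l
  refine Fin.lastCases ?_ (fun l' => ?_) l
  · simp
  · simp

/-- **Membership of `((v ∘ σ), v i, v j)` in a definable `S ⊆ M^{k+2}` is a definable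
condition on `v`** — the atom "`(x, r, s) ∈ Y`" of the conditions of van den Dries 1998,
Ch. 3, (2.13), with `x`, `r`, `s` among the variables of `v`. [cite: Dries1998, Ch. 1 (2.3)] -/
theorem definable_setOf_snoc_snoc_mem {k : ℕ} {S : Set (Fin (k + 2) → M)}
    (hS : (univ : Set M).Definable L S) (σ : Fin k → γ) (i j : γ) :
    (univ : Set M).Definable L {v : γ → M |
      (Fin.snoc (Fin.snoc (fun l => v (σ l)) (v i) : Fin (k + 1) → M) (v j) : Fin (k + 2) → M) ∈ S} := by
  have h := definable_setOf_comp_mem hS (Fin.snoc (Fin.snoc σ i : Fin (k + 1) → γ) j)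
  convert h using 1
  ext v
  simp only [mem_setOf_eq]
  rw [snoc_snoc_comp_eq]

/-- **Membership of `((v ∘ σ), v i)` in a definable `S ⊆ M^{k+1}` is a definable condition on
`v`.** [cite: Dries1998, Ch. 1 (2.3)] -/
theorem definable_setOf_snoc_mem' {k : ℕ} {S : Set (Fin (k + 1) → M)}
    (hS : (univ : Set M).Definable L S) (σ : Fin k → γ) (i : γ) :
    (univ : Set M).Definable L {v : γ → M |
      (Fin.snoc (fun l => v (σ l)) (v i) : Fin (k + 1) → M) ∈ S} := by
  have h := definable_setOf_comp_mem hS (Fin.snoc σ i)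
  convert h using 1
  ext v
  simp only [mem_setOf_eq]
  rw [snoc_comp_eq]

/-! ### Finite conjunctions -/

/-- A conjunction indexed by a finite type of definable conditions is definable. [cite: Dries1998, Ch. 1 (2.3)] -/
theorem definable_setOf_forall_index {ι : Type*} [Finite ι] {P : ι → (γ → M) → Prop}
    (h : ∀ l, (univ : Set M).Definable L {v : γ → M | P l v}) :
    (univ : Set M).Definable L {v : γ → M | ∀ l, P l v} := by
  have heq : {v : γ → M | ∀ l, P l v} = ⋂ l, {v | P l v} := by
    ext v
    simp only [mem_setOf_eq, mem_iInter]
  rw [heq]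
  exact definable_iInter_of_finite h

/-- **"`x` lies in the box `(a, b)`"** is a definable condition, for coordinates of `x`, `a`,
`b` among the variables: `{v | ∀ l, v (a l) < v (x l) ∧ v (x l) < v (b l)}` (`<` definable). [cite: Dries1998, Ch. 1 (2.3)] -/
theorem definable_setOf_mem_box [LT M] (hlt : (univ : Set M).Definable L {v : Fin 2 → M | v 0 < v 1})
    {ι : Type*} [Finite ι] (a x b : ι → γ) :
    (univ : Set M).Definable L {v : γ → M | ∀ l, v (a l) < v (x l) ∧ v (x l) < v (b l)} :=
  definable_setOf_forall_index fun _ => definable_setOf_and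
    (definable_setOf_lt hlt (definableFun_proj _) (definableFun_proj _))
    (definable_setOf_lt hlt (definableFun_proj _) (definableFun_proj _))

end Literature.ModelTheory.ExponentialFields
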